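import Summits.ABC.ABC.Theorems.PrimePowerRadical.Negative.WieferichValuations
import Summits.ABC.ABC.Theorems.PrimePowerRadical.Negative.Tightness

/-!
# `PrimePowerRadical` (stmt-ABC-1648): inside the family, unconditional refutations stop exactly at linear loss

Negative-side support (cdisprove seat). The `ε = 0` crux with a polynomial loss, `q^k < C · k^A · rad(1·(q^k−1)·q^k)`:
FALSE for every `A < 1` at every prime base (`not_sublinear_loss`; the lifting-the-exponent family `k = (p−1)p^j`
has `p^{j+1} ∣ q^k − 1`, excess `≥ p^j = k/(p−1)`: `lte_family`), OPEN for every `A ≥ 1` in both directions (by the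
sandwich of `Negative/WieferichValuations.lean` it is a bound on the Wieferich excess `E_W(q,k)`). Contrast: for abc
at large every polylog loss is refuted (`Literature.Barriers.ABC.not_abc_polylog_loss`, Bombieri–Gubler Prop. 12.4.12)
— by Stewart–Tijdeman/pigeonhole triples, which are not of the form `(1, q^k − 1, q^k)`.
-/

noncomputable section

namespace Summit.ABC.ABC.Theorems.PrimePowerRadical.Negative

open Literature.NumberTheory.DiophantineGeometry UniqueFactorizationMonoid

/-- If `p^{j+1} ∣ b ≠ 0` (`p` prime) then `radical b · p^j ∣ b`. [folklore] -/
theorem radical_mul_pow_dvd {p b j : ℕ} (hp : p.Prime) (hb : b ≠ 0) (h : p ^ (j + 1) ∣ b) :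
    radical b * p ^ j ∣ b := by
  haveI := Fact.mk hp
  have hR : radical b ≠ 0 := radical_ne_zero
  have hpj : p ^ j ≠ 0 := pow_ne_zero _ hp.ne_zero
  rw [← Nat.factorization_le_iff_dvd (mul_ne_zero hR hpj) hb, Nat.factorization_mul hR hpj,
    Finsupp.le_def]
  intro r
  rw [Finsupp.add_apply, factorization_radical, hp.factorization_pow, Finsupp.single_apply]
  by_cases hrb : r ∈ b.primeFactors
  · have hr := Nat.prime_of_mem_primeFactors hrb
    rw [if_pos hrb, Nat.factorization_def _ hr]
    by_cases hpr : p = r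
    · subst hpr
      rw [if_pos rfl]
      have := (padicValNat_dvd_iff_le hb).mp h
      omega
    · rw [if_neg hpr]
      haveI := Fact.mk hr
      simpa using one_le_padicValNat_of_dvd hb (Nat.dvd_of_mem_primeFactors hrb)
  · rw [if_neg hrb]
    by_cases hpr : p = r
    · subst hpr
      exact absurd (Nat.mem_primeFactors.mpr ⟨hp, dvd_trans (dvd_pow_self p (by omega)) h, hb⟩) hrb
    · rw [if_neg hpr]; simp

/-- **The LTE family: linear excess at every prime base.** For primes `q ≠ p`, `p` odd, and every `j`,
with `k = (p−1)p^j`: `p^{j+1} ∣ q^k − 1`, hence `rad(1·(q^k−1)·q^k) · p^j ≤ (q^k − 1)·q`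
(excess `≥ p^j = k/(p−1)`; for `q = 2, p = 3`: `3^{j+1} ∣ 2^{2·3^j} − 1`). [folklore] -/
theorem lte_family {q p : ℕ} (hq : q.Prime) (hp : p.Prime) (hp2 : p ≠ 2) (hpq : p ≠ q) (j : ℕ) :
    rad 1 (q ^ ((p - 1) * p ^ j) - 1) (q ^ ((p - 1) * p ^ j)) * p ^ j
      ≤ (q ^ ((p - 1) * p ^ j) - 1) * q := by
  set k := (p - 1) * p ^ j with hk
  have hk1 : 1 ≤ k :=
    Nat.one_le_iff_ne_zero.mpr (mul_ne_zero (by have := hp.two_le; omega) (pow_ne_zero _ hp.ne_zero))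
  have h2 := two_le_pow hq.two_le hk1
  have hn : q ^ k - 1 ≠ 0 := by omega
  have hpq' : ¬ p ∣ q := fun h => hpq ((Nat.prime_dvd_prime_iff_eq hp hq).mp h)
  have hpk : p ∣ q ^ k - 1 := by
    have h1 : p ∣ q ^ (p - 1) - 1 := by
      simpa using Dioph.prime_dvd_pow_sub_pow_fermat hp hpq'
        (fun h => hp.one_lt.ne' (Nat.dvd_one.mp h)) hq.one_lt.le
    have h2 : q ^ (p - 1) - 1 ∣ q ^ k - 1 := by
      have := Nat.sub_dvd_pow_sub_pow (q ^ (p - 1)) 1 (p ^ j)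
      rwa [one_pow, ← pow_mul] at this
    exact dvd_trans h1 h2
  have hv : padicValNat p (q ^ k - 1) = wieferichLevel q p + padicValNat p k :=
    padicValNat_family hq.two_le hp hp2 hk1 hpk
  haveI := Fact.mk hp
  have hvk : padicValNat p k = j := by
    rw [hk, padicValNat.mul (by have := hp.two_le; omega) (pow_ne_zero _ hp.ne_zero),
      padicValNat.prime_pow, padicValNat.eq_zero_of_not_dvd]
    · simp
    · intro h
      have := Nat.le_of_dvd (by have := hp.two_le; omega) h
      have := hp.two_le
      omega
  have hW := one_le_wieferichLevel hp hq.two_le hpq'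
  have hdiv : p ^ (j + 1) ∣ q ^ k - 1 := by
    refine (padicValNat_dvd_iff_le hn).mpr ?_
    omega
  have hrad : radical (q ^ k - 1) * p ^ j ∣ q ^ k - 1 := radical_mul_pow_dvd hp hn hdiv
  have hle := Nat.le_of_dvd (by omega) hrad
  rw [rad_family_eq hq hk1]
  calc radical (q ^ k - 1) * q * p ^ j = radical (q ^ k - 1) * p ^ j * q := by ring
    _ ≤ (q ^ k - 1) * q := Nat.mul_le_mul_right q hle

/-- **No sublinear loss, at any prime base**: for `A < 1` there is no `C` with
`q^k < C · k^A · rad(1·(q^k−1)·q^k)` for all `k ≥ 1`. (`A = 0` is `not_exponent_one`; `A ≥ 1` is open.) [folklore] -/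
theorem not_sublinear_loss (q : ℕ) (hq : q.Prime) {A : ℝ} (hA : A < 1) :
    ¬ ∃ C : ℝ, ∀ k : ℕ, 1 ≤ k →
      ((q ^ k : ℕ) : ℝ) < C * (k : ℝ) ^ A * ((rad 1 (q ^ k - 1) (q ^ k) : ℕ) : ℝ) := by
  rintro ⟨C, hC⟩
  obtain ⟨p, hpge, hp⟩ := Nat.exists_infinite_primes (q + 2)
  have hp2 : p ≠ 2 := by have := hq.two_le; omega
  have hpq : p ≠ q := by omega
  have hp0 : (0 : ℝ) < p := by exact_mod_cast hp.pos
  have hp1 : (1 : ℝ) < p := by exact_mod_cast hp.one_lt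
  have hq0 : (0 : ℝ) < q := by exact_mod_cast hq.pos
  have hlogp : 0 < Real.log p := Real.log_pos hp1
  have hpm1 : (0 : ℝ) < (p : ℝ) - 1 := by linarith
  have hcast : ((p - 1 : ℕ) : ℝ) = (p : ℝ) - 1 := by
    rw [Nat.cast_sub hp.one_lt.le]; simp
  set B : ℝ := C * q * ((p : ℝ) - 1) ^ A with hB
  have key : ∀ j : ℕ, (p : ℝ) ^ ((1 - A) * j) < B := by
    intro j
    set k := (p - 1) * p ^ j with hk
    have hk1 : 1 ≤ k :=
      Nat.one_le_iff_ne_zero.mpr (mul_ne_zero (by have := hp.two_le; omega) (pow_ne_zero _ hp.ne_zero))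
    have h1 := hC k hk1
    have h2 := lte_family hq hp hp2 hpq j
    have hR0 : (0 : ℝ) < ((rad 1 (q ^ k - 1) (q ^ k) : ℕ) : ℝ) := by
      have := two_le_rad_family hq.two_le hk1
      exact_mod_cast (by omega : 0 < rad 1 (q ^ k - 1) (q ^ k))
    have hqk : (0 : ℝ) < (q : ℝ) ^ k := by positivity
    have h2R : ((rad 1 (q ^ k - 1) (q ^ k) : ℕ) : ℝ) * (p : ℝ) ^ j < (q : ℝ) ^ k * q := by
      have h2' : rad 1 (q ^ k - 1) (q ^ k) * p ^ j < q ^ k * q :=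
        lt_of_le_of_lt h2
          (Nat.mul_lt_mul_of_pos_right (Nat.sub_lt (pow_pos hq.pos k) one_pos) hq.pos)
      have : ((rad 1 (q ^ k - 1) (q ^ k) * p ^ j : ℕ) : ℝ) < ((q ^ k * q : ℕ) : ℝ) := by
        exact_mod_cast h2'
      push_cast at this
      exact this
    have h1' : (q : ℝ) ^ k < C * (k : ℝ) ^ A * ((rad 1 (q ^ k - 1) (q ^ k) : ℕ) : ℝ) := by
      have := h1; push_cast at this; exact this
    have hkA : (0 : ℝ) < (k : ℝ) ^ A := Real.rpow_pos_of_pos (by exact_mod_cast (by omega : 0 < k)) A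
    have hC0 : 0 < C := by
      by_contra hle
      have h3 : C * (k : ℝ) ^ A ≤ 0 := mul_nonpos_of_nonpos_of_nonneg (le_of_not_gt hle) hkA.le
      have h4 : C * (k : ℝ) ^ A * ((rad 1 (q ^ k - 1) (q ^ k) : ℕ) : ℝ) ≤ 0 :=
        mul_nonpos_of_nonpos_of_nonneg h3 hR0.le
      linarith
    have hpj : (0 : ℝ) < (p : ℝ) ^ j := by positivity
    have h3 : (q : ℝ) ^ k * (p : ℝ) ^ j < C * (k : ℝ) ^ A * ((q : ℝ) ^ k * q) := by
      calc (q : ℝ) ^ k * (p : ℝ) ^ j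
          < C * (k : ℝ) ^ A * ((rad 1 (q ^ k - 1) (q ^ k) : ℕ) : ℝ) * (p : ℝ) ^ j :=
            mul_lt_mul_of_pos_right h1' hpj
        _ = C * (k : ℝ) ^ A * (((rad 1 (q ^ k - 1) (q ^ k) : ℕ) : ℝ) * (p : ℝ) ^ j) := by ring
        _ < C * (k : ℝ) ^ A * ((q : ℝ) ^ k * q) := mul_lt_mul_of_pos_left h2R (mul_pos hC0 hkA)
    have h4 : (p : ℝ) ^ j < C * (k : ℝ) ^ A * q := by
      have : (q : ℝ) ^ k * (p : ℝ) ^ j < (q : ℝ) ^ k * (C * (k : ℝ) ^ A * q) := by linarith [h3]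
      exact lt_of_mul_lt_mul_left this hqk.le
    have h5 : (k : ℝ) ^ A = ((p : ℝ) - 1) ^ A * (p : ℝ) ^ (A * j) := by
      rw [hk]; push_cast
      rw [hcast, Real.mul_rpow hpm1.le (by positivity), ← Real.rpow_natCast (p : ℝ) j,
        ← Real.rpow_mul hp0.le, mul_comm (j : ℝ) A]
    have h6 : (p : ℝ) ^ j = (p : ℝ) ^ (A * j) * (p : ℝ) ^ ((1 - A) * j) := by
      rw [← Real.rpow_add hp0, ← Real.rpow_natCast]; ring_nf
    rw [h5, h6] at h4
    have hpA : (0 : ℝ) < (p : ℝ) ^ (A * j) := Real.rpow_pos_of_pos hp0 _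
    have h7 : (p : ℝ) ^ (A * j) * (p : ℝ) ^ ((1 - A) * j) < (p : ℝ) ^ (A * j) * B := by
      calc _ < C * (((p : ℝ) - 1) ^ A * (p : ℝ) ^ (A * j)) * q := h4
        _ = (p : ℝ) ^ (A * j) * B := by rw [hB]; ring
    exact lt_of_mul_lt_mul_left h7 hpA.le
  obtain ⟨j, hj⟩ := exists_nat_gt (B / ((1 - A) * Real.log p))
  have h := key j
  have hexp : 1 + (1 - A) * j * Real.log p ≤ (p : ℝ) ^ ((1 - A) * j) := by
    rw [Real.rpow_def_of_pos hp0]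
    have := Real.add_one_le_exp (Real.log p * ((1 - A) * j))
    nlinarith
  rw [div_lt_iff₀ (mul_pos (by linarith) hlogp)] at hj
  nlinarith

end Summit.ABC.ABC.Theorems.PrimePowerRadical.Negative

end
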